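import Summits.HodgeConjecture.HodgeConjecture.Theorems.R90S4StableClassCartanType          -- ★ p863391 (K2E3-p12): `IsStablyConjGAt`, `splitFormGL`, `Gqs` frame of (B2-S)
import Summits.HodgeConjecture.HodgeConjecture.Theorems.R90S4SplitCartanClassCalculus       -- ★ p864066 F2a (this seat): frame class calculus (`exists_eq_conj_diagonal_of_mem_unitaryGroup_of_commute`, `exists_coords_of_conj_mem_unitaryGroup`, …)
import Literature.NumberTheory.Rogawski1990.LocalStableClassesNonsplitTypeOneOfCharpoly      -- ★ (P3a L4a) type (1): `exists_unitary_conj_iff_forall_normTest_iff`, `normTest_zero_iff_normTest_one_iff_two`, `exists_eigenframe_and_forall_exists_conj_mem_of_charpoly`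
import Literature.NumberTheory.Weil1982.UnitaryLocalRingBaseField                           -- ★ `exists_complexConj_eq_neg_ne_zero`, ★ `conjLocal_conjLocal`
import HarnessLib

/-!
# R90-TF · S4 «Ch. 13.1–2», (DICT)(1) file F3a — THE FOUR CLASSES AT EVERY REGULAR POINT OF A TYPE-(1) TORUS, IN `Gqs` CURRENCY: realisers chosen for `γ₀` serve every regular
# `t ∈ Z(γ₀)` (same eigenframe), the map `j ↦ ⟦g_j t g_j⁻¹⟧` (`j < 4`) is injective and exhausts the stable class of `t` (Rogawski 1990, §3.5 Prop. 3.5.2 (a)(c), §3.6 p. 30)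

Cell `hodgecm-mathlib`, crux H413 (`stmt-HodgeConjecture-24833`, lane `--supports … --as helper`), route of record `HCCMUnconditional` (no route verbs; count-neutral).
Programme R90-TF, section S4 (base `R90-C131`), dealer K2E2-plan (g7), hand (DICT)(1) «`(E¹)³` TYPE» (GO 2026-09-05T01:10:20Z); seat R90-C131-p01 (g2).  After the census correction of
01:2xZ: the type-(1) class set at a non-split place is ★ in Literature (programme P3a brick (L4a): `LocalStableClassesNonsplit{,TypeOneCount,TypeOneOfCharpoly}`, in
`unitaryGroup (conjLocal E c v) H` currency, for the element `γ` carrying the eigenframe); THIS FILE moves it to (a) the `Gqs L v` ∕ `IsStablyConjGAt` currency of p12's dictionary and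
(b) EVERY regular point `t` of the torus `Z(γ₀)` with the realisers chosen ONCE for `γ₀` — the two things the (B) clause of the member package needs (F3b).  THEOREMS ONLY; ★-only imports.

## THE MATHEMATICS
`G_v = Gqs L v = U(Φ₃)(L⁺_v)`, `v` NON-SPLIT (`L ⊗ L⁺_v = L_w` a field), `σ = c ⊗ 1`, `H = Φ₃` (★ `cmLocalForm L 3 v`).  Let `γ₀ ∈ G_v` be of type (1): eigenframe `γ₀ P = P·diag(u)`, `u` injective,
`σ(uᵢ)uᵢ = 1`.  (§2) A regular `t ∈ Z_{G_v}(γ₀)` is again of type (1) IN THE SAME FRAME: `t P = P·diag(ν)`, `ν` injective, `σ(νᵢ)νᵢ = 1` (★ F2a: `t ∈ Z(γ₀) = P·Diag·P⁻¹` and `t⋆t = 1`;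
regular ⇔ `ν` injective).  (§3) A realiser `g` of a class of `γ₀` (`gγ₀g⁻¹ ∈ U`) carries EVERY `t ∈ Z(γ₀) ∩ U` into `U` (`H_g = H·[c]`, ★ F2a), and its NORM TESTS `NTᵢ(g)`:
«`⟨g pᵢ, g pᵢ⟩ ∈ N·⟨pᵢ, pᵢ⟩`» do not mention `t`.  Hence, with four realisers `g_j` whose tests read the four sum-zero sign vectors `ε_j ∈ (ℤ∕2)³` (rows of
`(0,0,0), (0,1,1), (1,0,1), (1,1,0)`; they EXIST by ★ `exists_eigenframe_and_forall_exists_conj_mem_of_charpoly`): (§4) at every regular `t ∈ Z(γ₀)`, `g_j t g_j⁻¹ ∼_U g_k t g_k⁻¹ ⇒ j = k`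
(★ criterion `exists_unitary_conj_iff_forall_normTest_iff` AT `t`) and every `δ ∼_{st} t` is `∼_U g_j t g_j⁻¹` for some `j` (★ parity `normTest_zero_iff_normTest_one_iff_two` AT `t`: the
failure set of `NT(g)` is even, so it is some `ε_j`; then the criterion) — «`𝔇(T∕F) ≅ {ε : Σ εᵢ = 0}`, four classes, uniformly along `T^{reg}`» [Prop. 3.5.2 (c), §3.6 (1)].
(§1) plumbing: `unitaryGroupOfForm = unitaryGroup` on `GL₃(L_w)` (two spellings of `U(Φ₃)`), `U`-conjugacy at `GL₃` level ⇔ `ConjClasses.mk` equality in `Gqs`, `IsStablyConjGAt ⇔ ∃ g, gtg⁻¹ = δ`.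

## CONTENTS
* §1 `unitaryGroupOfForm_cmLocalForm_eq_unitaryGroup`, `conjClassesMk_eq_of_exists_unitary_conj`, `exists_unitary_conj_of_conjClassesMk_eq`, `isStablyConjGAt_iff_exists_conj_eq`.
* §2 `exists_eigenframe_coords_of_mem_centralizer`.
* §3 `conj_mem_unitaryGroup_of_mem_centralizer`.
* §4 `eq_of_unitary_conj_realisers`, `exists_realiser_unitary_conj_of_isStablyConjGAt`.

HONEST LABEL: HC_CM is proved only modulo the 7 printed citations (2 remaining named inputs: hLiu418 = stmt-HodgeConjecture-24832, h413 = stmt-HodgeConjecture-24833) until rung 0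
closes.  Input of the type-(1) member package ((DICT)(1), F3b) behind ★ (B2-S) behind the OPEN (W-NP); discharges no named input.  REL ≠ ★ ≠ BUILT.

## References
* [Rogawski1990] J. D. Rogawski, *Automorphic Representations of Unitary Groups in Three Variables*, Ann. of Math. Stud. 123 (1990), §3.1 p. 19, §3.5 Prop. 3.5.2 (a)(c) p. 29,
  §3.6 pp. 30–31.
* [Kottwitz1986] R. E. Kottwitz, *Stable trace formula: elliptic singular terms*, Math. Ann. 275 (1986), §7.
-/

set_option autoImplicit false
set_option linter.dupNamespace false

noncomputable section

open NumberField IsDedekindDomain Polynomial Matrix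
open scoped MatrixGroups
open Literature.NumberTheory.Rogawski1990 Literature.NumberTheory.Automorphic Literature.NumberTheory.Automorphic.UnitaryGroup
open Literature.AlgebraicGeometry.ShimuraVarieties (unitaryGroup mem_unitaryGroup_iff)
open Summit.HodgeConjecture.HodgeConjecture.Cruxes.H413

namespace Summit.HodgeConjecture.HodgeConjecture.R90.S4

section TypeOneClasses

variable (L : Type) [Field L] [NumberField L] [IsCMField L] (v : HeightOneSpectrum (𝓞 ↥(maximalRealSubfield L)))

/-! ## §1 Plumbing between the two spellings of `U(Φ₃)(L⁺_v)` -/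

/-- The two renderings of `U(Φ₃)(L⁺_v) ≤ GL₃(L ⊗ L⁺_v)` (★ `unitaryGroupOfForm`, the carrier of `Gqs L v`; ★ `unitaryGroup`, the carrier of the Literature (L4a) bricks) are the
same subgroup. [cite: Rogawski1990, §3.1 p. 19] -/
theorem unitaryGroupOfForm_cmLocalForm_eq_unitaryGroup :
    unitaryGroupOfForm (conjLocal L (IsCMField.complexConj L) v) (cmLocalForm L 3 v) = unitaryGroup (conjLocal L (IsCMField.complexConj L) v) (cmLocalForm L 3 v) :=
  Subgroup.ext fun _ => Iff.rfl

variable {L v}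

/-- `U`-conjugacy read at `GL₃` level gives equality of classes in `Gqs L v`. [cite: Rogawski1990, §3.1 p. 19] -/
theorem conjClassesMk_eq_of_exists_unitary_conj {a b : Gqs L v}
    (h : ∃ w : GL (Fin 3) (LocalRing L v), w ∈ unitaryGroup (conjLocal L (IsCMField.complexConj L) v) (cmLocalForm L 3 v) ∧ w * a.val * w⁻¹ = b.val) :
    ConjClasses.mk a = ConjClasses.mk b := by
  obtain ⟨w, hw, hc⟩ := h
  have hw' : w ∈ unitaryGroupOfForm (conjLocal L (IsCMField.complexConj L) v) (cmLocalForm L 3 v) := by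
    rw [unitaryGroupOfForm_cmLocalForm_eq_unitaryGroup]; exact hw
  refine ConjClasses.mk_eq_mk_iff_isConj.2 (isConj_iff.2 ⟨⟨w, hw'⟩, Subtype.ext ?_⟩)
  exact hc

/-- … and conversely. [cite: Rogawski1990, §3.1 p. 19] -/
theorem exists_unitary_conj_of_conjClassesMk_eq {a b : Gqs L v} (h : ConjClasses.mk a = ConjClasses.mk b) :
    ∃ w : GL (Fin 3) (LocalRing L v), w ∈ unitaryGroup (conjLocal L (IsCMField.complexConj L) v) (cmLocalForm L 3 v) ∧ w * a.val * w⁻¹ = b.val := by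
  obtain ⟨c, hc⟩ := isConj_iff.1 (ConjClasses.mk_eq_mk_iff_isConj.1 h)
  refine ⟨c.val, ?_, ?_⟩
  · rw [← unitaryGroupOfForm_cmLocalForm_eq_unitaryGroup]; exact c.2
  · exact congrArg Subtype.val hc

/-- `IsStablyConjGAt` (conjugacy in `G̃_v = GL₃(L ⊗ L⁺_v)`) unfolded to a conjugator. [cite: Rogawski1990, §3.1 p. 19] -/
theorem isStablyConjGAt_iff_exists_conj_eq (a b : Gqs L v) :
    IsStablyConjGAt L (R90.S4.splitFormGL L) v a b ↔ ∃ g : GL (Fin 3) (LocalRing L v), g * a.val * g⁻¹ = b.val :=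
  isConj_iff

/-! ## §2 Regular points of a type-(1) torus are of type (1) in the same frame -/

set_option maxHeartbeats 800000 in
/-- **A REGULAR `t ∈ Z(γ₀)` HAS THE SAME EIGENFRAME**: if `γ₀ P = P·diag(u)` (`u` injective, `σ(uᵢ)uᵢ = 1`) and `t ∈ Z_{G_v}(γ₀)` is regular, then `t P = P·diag(ν)` with `ν` injective and
`σ(νᵢ)νᵢ = 1` (★ F2a `exists_eq_conj_diagonal_of_mem_unitaryGroup_of_commute` + `injective_of_charpoly_conj_diagonal_separable`). [cite: Rogawski1990, §3.6 p. 30] -/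
theorem exists_eigenframe_coords_of_mem_centralizer (hns : ∀ w : PlacesOver L v, IsCMField.complexConj L • w.1 = w.1)
    {γ₀ : Gqs L v} {P : GL (Fin 3) (LocalRing L v)} {u : Fin 3 → LocalRing L v}
    (hP : γ₀.val.val * P.val = P.val * diagonal u) (hu : Function.Injective u) (hu1 : ∀ k, conjLocal L (IsCMField.complexConj L) v (u k) * u k = 1)
    {t : Gqs L v} (ht : t ∈ Subgroup.centralizer ({γ₀} : Set (Gqs L v))) (hreg : IsRegularElt (t.val : GL (Fin 3) (LocalRing L v))) :
    ∃ ν : Fin 3 → LocalRing L v, t.val.val * P.val = P.val * diagonal ν ∧ Function.Injective ν ∧ ∀ k, conjLocal L (IsCMField.complexConj L) v (ν k) * ν k = 1 := by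
  obtain ⟨w⟩ := (inferInstance : Nonempty (PlacesOver L v))
  letI : Field (LocalRing L v) := (LocalRing.isField_of_smul_eq (IsCMField.complexConj L) (IsCMField.complexConj_ne_one L) w (hns w)).toField
  have hH : IsUnit (cmLocalForm L 3 v).det := by
    rw [cmLocalForm_eq_over]; exact (Matrix.isUnit_iff_isUnit_det _).1 ((StdForm.antidiagonal 3).isUnit_over _)
  have hγU : γ₀.val ∈ unitaryGroup (conjLocal L (IsCMField.complexConj L) v) (cmLocalForm L 3 v) := by
    rw [← unitaryGroupOfForm_cmLocalForm_eq_unitaryGroup]; exact γ₀.2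
  have htU : t.val ∈ unitaryGroup (conjLocal L (IsCMField.complexConj L) v) (cmLocalForm L 3 v) := by
    rw [← unitaryGroupOfForm_cmLocalForm_eq_unitaryGroup]; exact t.2
  have hP' : γ₀.val.val = P.val * diagonal u * P⁻¹.val := by
    rw [← hP, Matrix.mul_assoc, units_mul_inv_val, Matrix.mul_one]
  have htc : Commute t.val.val γ₀.val.val := by
    have h1 := Subgroup.mem_centralizer_singleton_iff.1 ht
    exact congrArg (fun g : Gqs L v => g.val.val) h1
  obtain ⟨ν, htν, hν1⟩ := exists_eq_conj_diagonal_of_mem_unitaryGroup_of_commute (conjLocal L (IsCMField.complexConj L) v) (cmLocalForm L 3 v)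
    hγU hu hu1 P hP' hH htU htc
  refine ⟨ν, ?_, injective_of_charpoly_conj_diagonal_separable P htν ((isRegularElt_iff _).1 hreg), hν1⟩
  rw [htν, Matrix.mul_assoc, units_inv_mul_val, Matrix.mul_one]

/-! ## §3 A realiser for `γ₀` carries the whole torus into `U` -/

set_option maxHeartbeats 800000 in
/-- **REALISERS SERVE THE WHOLE TORUS**: if `g γ₀ g⁻¹ ∈ U(Φ₃)` and `t ∈ Z_{G_v}(γ₀)`, then `g t g⁻¹ ∈ U(Φ₃)` — the class `H_g = H·[c]` lies in `Z(γ₀) = P·Diag·P⁻¹` (★ F2a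
`exists_coords_of_conj_mem_unitaryGroup`) and commutes with `t = [ν]` (★ F2a `conj_mem_unitaryGroup_of_twistGram_eq_frame`). [cite: Rogawski1990, §3.5 Prop. 3.5.2 (a) p. 29] -/
theorem conj_mem_unitaryGroup_of_mem_centralizer (hns : ∀ w : PlacesOver L v, IsCMField.complexConj L • w.1 = w.1)
    {γ₀ : Gqs L v} {P : GL (Fin 3) (LocalRing L v)} {u : Fin 3 → LocalRing L v}
    (hP : γ₀.val.val * P.val = P.val * diagonal u) (hu : Function.Injective u) (hu1 : ∀ k, conjLocal L (IsCMField.complexConj L) v (u k) * u k = 1)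
    {g : GL (Fin 3) (LocalRing L v)} (hg : g * γ₀.val * g⁻¹ ∈ unitaryGroup (conjLocal L (IsCMField.complexConj L) v) (cmLocalForm L 3 v))
    {t : Gqs L v} (ht : t ∈ Subgroup.centralizer ({γ₀} : Set (Gqs L v))) :
    g * t.val * g⁻¹ ∈ unitaryGroup (conjLocal L (IsCMField.complexConj L) v) (cmLocalForm L 3 v) := by
  obtain ⟨w⟩ := (inferInstance : Nonempty (PlacesOver L v))
  letI : Field (LocalRing L v) := (LocalRing.isField_of_smul_eq (IsCMField.complexConj L) (IsCMField.complexConj_ne_one L) w (hns w)).toField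
  have hH : IsUnit (cmLocalForm L 3 v).det := by
    rw [cmLocalForm_eq_over]; exact (Matrix.isUnit_iff_isUnit_det _).1 ((StdForm.antidiagonal 3).isUnit_over _)
  have hHh : ((cmLocalForm L 3 v).map (conjLocal L (IsCMField.complexConj L) v))ᵀ = cmLocalForm L 3 v := by
    rw [cmLocalForm_eq_over, StdForm.over_map, StdForm.transpose_over]
  have hσ : ∀ r : LocalRing L v, conjLocal L (IsCMField.complexConj L) v (conjLocal L (IsCMField.complexConj L) v r) = r :=
    Literature.NumberTheory.Weil1982.UnitaryFinTopForm.conjLocal_conjLocal L v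
  have hγU : γ₀.val ∈ unitaryGroup (conjLocal L (IsCMField.complexConj L) v) (cmLocalForm L 3 v) := by
    rw [← unitaryGroupOfForm_cmLocalForm_eq_unitaryGroup]; exact γ₀.2
  have htU : t.val ∈ unitaryGroup (conjLocal L (IsCMField.complexConj L) v) (cmLocalForm L 3 v) := by
    rw [← unitaryGroupOfForm_cmLocalForm_eq_unitaryGroup]; exact t.2
  have hP' : γ₀.val.val = P.val * diagonal u * P⁻¹.val := by
    rw [← hP, Matrix.mul_assoc, units_mul_inv_val, Matrix.mul_one]
  have htc : Commute t.val.val γ₀.val.val := by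
    have h1 := Subgroup.mem_centralizer_singleton_iff.1 ht
    exact congrArg (fun g : Gqs L v => g.val.val) h1
  -- the class of `g` in the frame of `γ₀`
  obtain ⟨c, hc, -, -⟩ := exists_coords_of_conj_mem_unitaryGroup (conjLocal L (IsCMField.complexConj L) v) (cmLocalForm L 3 v)
    hγU hu hu1 P hP' hH hσ hHh hγU hu hP' hg
  -- `t` in the frame
  obtain ⟨ν, htν, -⟩ := exists_eq_conj_diagonal_of_mem_unitaryGroup_of_commute (conjLocal L (IsCMField.complexConj L) v) (cmLocalForm L 3 v)
    hγU hu hu1 P hP' hH htU htc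
  exact conj_mem_unitaryGroup_of_twistGram_eq_frame (conjLocal L (IsCMField.complexConj L) v) (cmLocalForm L 3 v) P htU htν hc

/-! ## §4 Four realisers chosen for `γ₀` classify the stable class of every regular `t ∈ Z(γ₀)` -/

set_option maxHeartbeats 800000 in
/-- **INJECTIVITY AT EVERY REGULAR POINT**: let `g : Fin 4 → GL₃` realise classes of `γ₀` (`g_j γ₀ g_j⁻¹ ∈ U`) with norm tests reading the rows `ε_j` of a sign table `ε` with pairwise
distinct rows (`NTᵢ(g_j) ⇔ ε_j i = 0`).  Then for every regular `t ∈ Z_{G_v}(γ₀)`: `g_j t g_j⁻¹ ∼_U g_k t g_k⁻¹ ⇒ j = k` (★ criterion `exists_unitary_conj_iff_forall_normTest_iff` AT `t`, same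
frame). [cite: Rogawski1990, §3.5 Prop. 3.5.2 (a)(c) p. 29; §3.6 p. 30] -/
theorem eq_of_unitary_conj_realisers (hns : ∀ w : PlacesOver L v, IsCMField.complexConj L • w.1 = w.1)
    {γ₀ : Gqs L v} {P : GL (Fin 3) (LocalRing L v)} {u : Fin 3 → LocalRing L v}
    (hP : γ₀.val.val * P.val = P.val * diagonal u) (hu : Function.Injective u) (hu1 : ∀ k, conjLocal L (IsCMField.complexConj L) v (u k) * u k = 1)
    {m : ℕ} (ε : Fin m → Fin 3 → ZMod 2) (hεinj : ∀ j k, (∀ i, ε j i = ε k i) → j = k)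
    (g : Fin m → GL (Fin 3) (LocalRing L v)) (hgU : ∀ j, g j * γ₀.val * (g j)⁻¹ ∈ unitaryGroup (conjLocal L (IsCMField.complexConj L) v) (cmLocalForm L 3 v))
    (hNT : ∀ j i, (∃ z : LocalRing L v, IsUnit z ∧
        twistGram (conjLocal L (IsCMField.complexConj L) v) (cmLocalForm L 3 v) ((g j).val * P.val) i i =
          conjLocal L (IsCMField.complexConj L) v z * z * twistGram (conjLocal L (IsCMField.complexConj L) v) (cmLocalForm L 3 v) P.val i i) ↔ ε j i = 0)
    {t : Gqs L v} (ht : t ∈ Subgroup.centralizer ({γ₀} : Set (Gqs L v))) (hreg : IsRegularElt (t.val : GL (Fin 3) (LocalRing L v)))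
    {j k : Fin m}
    (h : ∃ w' : GL (Fin 3) (LocalRing L v), w' ∈ unitaryGroup (conjLocal L (IsCMField.complexConj L) v) (cmLocalForm L 3 v) ∧
      w' * (g j * t.val * (g j)⁻¹) * w'⁻¹ = g k * t.val * (g k)⁻¹) :
    j = k := by
  obtain ⟨w⟩ := (inferInstance : Nonempty (PlacesOver L v))
  obtain ⟨δ, hcδ, hδ⟩ := Literature.NumberTheory.Weil1982.UnitaryFinTopForm.exists_complexConj_eq_neg_ne_zero L
  have hH : IsUnit (cmLocalForm L 3 v).det := by
    rw [cmLocalForm_eq_over]; exact (Matrix.isUnit_iff_isUnit_det _).1 ((StdForm.antidiagonal 3).isUnit_over _)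
  have hHh : ((cmLocalForm L 3 v).map (conjLocal L (IsCMField.complexConj L) v))ᵀ = cmLocalForm L 3 v := by
    rw [cmLocalForm_eq_over, StdForm.over_map, StdForm.transpose_over]
  have htU : t.val ∈ unitaryGroup (conjLocal L (IsCMField.complexConj L) v) (cmLocalForm L 3 v) := by
    rw [← unitaryGroupOfForm_cmLocalForm_eq_unitaryGroup]; exact t.2
  obtain ⟨ν, htP, hν, hν1⟩ := exists_eigenframe_coords_of_mem_centralizer hns hP hu hu1 ht hreg
  have hgj := conj_mem_unitaryGroup_of_mem_centralizer hns hP hu hu1 (hgU j) ht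
  have hgk := conj_mem_unitaryGroup_of_mem_centralizer hns hP hu hu1 (hgU k) ht
  have hcrit := (exists_unitary_conj_iff_forall_normTest_iff L v (IsCMField.complexConj L) hcδ hδ w (hns w) hHh hH htU htP hν hν1 hgj hgk).1 h
  refine hεinj j k fun i => ?_
  have h1 : ε k i = 0 ↔ ε j i = 0 := by rw [← hNT k i, ← hNT j i]; exact hcrit i
  have hz2 : ∀ x : ZMod 2, x = 0 ∨ x = 1 := by decide
  rcases hz2 (ε j i) with hj0 | hj1 <;> rcases hz2 (ε k i) with hk0 | hk1
  · rw [hj0, hk0]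
  · exact absurd (h1.2 hj0) (by rw [hk1]; decide)
  · exact absurd (h1.1 hk0) (by rw [hj1]; decide)
  · rw [hj1, hk1]

set_option maxHeartbeats 800000 in
/-- **EXHAUSTION AT EVERY REGULAR POINT**: with the same data, if the rows of `ε` exhaust the sum-zero sign vectors, then every `δ ∈ G_v` stably conjugate to a regular `t ∈ Z_{G_v}(γ₀)` is
`U`-conjugate to `g_j t g_j⁻¹` for some `j` (★ parity `normTest_zero_iff_normTest_one_iff_two` AT `t` — the failure set of the norm tests of a stable conjugator of `t` is even — then the
criterion). [cite: Rogawski1990, §3.5 Prop. 3.5.2 (a)(c) p. 29; §3.6 p. 30] [cite: Kottwitz1986, §7] -/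
theorem exists_realiser_unitary_conj_of_isStablyConjGAt (hns : ∀ w : PlacesOver L v, IsCMField.complexConj L • w.1 = w.1)
    {γ₀ : Gqs L v} {P : GL (Fin 3) (LocalRing L v)} {u : Fin 3 → LocalRing L v}
    (hP : γ₀.val.val * P.val = P.val * diagonal u) (hu : Function.Injective u) (hu1 : ∀ k, conjLocal L (IsCMField.complexConj L) v (u k) * u k = 1)
    {m : ℕ} (ε : Fin m → Fin 3 → ZMod 2) (hεsurj : ∀ e : Fin 3 → ZMod 2, e 0 + e 1 + e 2 = 0 → ∃ j, ∀ i, ε j i = e i)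
    (g : Fin m → GL (Fin 3) (LocalRing L v)) (hgU : ∀ j, g j * γ₀.val * (g j)⁻¹ ∈ unitaryGroup (conjLocal L (IsCMField.complexConj L) v) (cmLocalForm L 3 v))
    (hNT : ∀ j i, (∃ z : LocalRing L v, IsUnit z ∧
        twistGram (conjLocal L (IsCMField.complexConj L) v) (cmLocalForm L 3 v) ((g j).val * P.val) i i =
          conjLocal L (IsCMField.complexConj L) v z * z * twistGram (conjLocal L (IsCMField.complexConj L) v) (cmLocalForm L 3 v) P.val i i) ↔ ε j i = 0)
    {t : Gqs L v} (ht : t ∈ Subgroup.centralizer ({γ₀} : Set (Gqs L v))) (hreg : IsRegularElt (t.val : GL (Fin 3) (LocalRing L v)))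
    {δ' : Gqs L v} (hδ' : IsStablyConjGAt L (R90.S4.splitFormGL L) v t δ') :
    ∃ j, ∃ w' : GL (Fin 3) (LocalRing L v), w' ∈ unitaryGroup (conjLocal L (IsCMField.complexConj L) v) (cmLocalForm L 3 v) ∧
      w' * (g j * t.val * (g j)⁻¹) * w'⁻¹ = δ'.val := by
  classical
  obtain ⟨w⟩ := (inferInstance : Nonempty (PlacesOver L v))
  obtain ⟨δ, hcδ, hδ⟩ := Literature.NumberTheory.Weil1982.UnitaryFinTopForm.exists_complexConj_eq_neg_ne_zero L
  have hH : IsUnit (cmLocalForm L 3 v).det := by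
    rw [cmLocalForm_eq_over]; exact (Matrix.isUnit_iff_isUnit_det _).1 ((StdForm.antidiagonal 3).isUnit_over _)
  have hHh : ((cmLocalForm L 3 v).map (conjLocal L (IsCMField.complexConj L) v))ᵀ = cmLocalForm L 3 v := by
    rw [cmLocalForm_eq_over, StdForm.over_map, StdForm.transpose_over]
  have htU : t.val ∈ unitaryGroup (conjLocal L (IsCMField.complexConj L) v) (cmLocalForm L 3 v) := by
    rw [← unitaryGroupOfForm_cmLocalForm_eq_unitaryGroup]; exact t.2
  obtain ⟨ν, htP, hν, hν1⟩ := exists_eigenframe_coords_of_mem_centralizer hns hP hu hu1 ht hreg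
  -- a stable conjugator of `t` onto `δ'`
  obtain ⟨g', hg'⟩ := (isStablyConjGAt_iff_exists_conj_eq t δ').1 hδ'
  have hg'U : g' * t.val * g'⁻¹ ∈ unitaryGroup (conjLocal L (IsCMField.complexConj L) v) (cmLocalForm L 3 v) := by
    rw [hg', ← unitaryGroupOfForm_cmLocalForm_eq_unitaryGroup]; exact δ'.2
  -- its sign vector `e` (failure set of the norm tests), even by the parity law
  set e : Fin 3 → ZMod 2 := fun i => if (∃ z : LocalRing L v, IsUnit z ∧
      twistGram (conjLocal L (IsCMField.complexConj L) v) (cmLocalForm L 3 v) (g'.val * P.val) i i =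
        conjLocal L (IsCMField.complexConj L) v z * z * twistGram (conjLocal L (IsCMField.complexConj L) v) (cmLocalForm L 3 v) P.val i i) then 0 else 1 with he
  have he0 : ∀ i, (e i = 0 ↔ ∃ z : LocalRing L v, IsUnit z ∧
      twistGram (conjLocal L (IsCMField.complexConj L) v) (cmLocalForm L 3 v) (g'.val * P.val) i i =
        conjLocal L (IsCMField.complexConj L) v z * z * twistGram (conjLocal L (IsCMField.complexConj L) v) (cmLocalForm L 3 v) P.val i i) := by
    intro i
    by_cases hi : ∃ z : LocalRing L v, IsUnit z ∧
      twistGram (conjLocal L (IsCMField.complexConj L) v) (cmLocalForm L 3 v) (g'.val * P.val) i i =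
        conjLocal L (IsCMField.complexConj L) v z * z * twistGram (conjLocal L (IsCMField.complexConj L) v) (cmLocalForm L 3 v) P.val i i
    · simp only [he, hi, if_true]
    · simp only [he, hi, if_false, iff_false]
      decide
  have hpar := normTest_zero_iff_normTest_one_iff_two L v (IsCMField.complexConj L) hcδ hδ w (hns w) hHh hH htU htP hν hν1 hg'U
  have hsum : e 0 + e 1 + e 2 = 0 := by
    have hz2 : ∀ x : ZMod 2, x = 0 ∨ x = 1 := by decide
    rw [← he0 0, ← he0 1, ← he0 2] at hpar
    rcases hz2 (e 0) with h0 | h0 <;> rcases hz2 (e 1) with h1 | h1 <;> rcases hz2 (e 2) with h2 | h2 <;>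
      simp only [h0, h1, h2] at hpar ⊢ <;> revert hpar <;> decide
  obtain ⟨j, hj⟩ := hεsurj e hsum
  have hgj := conj_mem_unitaryGroup_of_mem_centralizer hns hP hu hu1 (hgU j) ht
  refine ⟨j, ?_⟩
  rw [← hg']
  refine (exists_unitary_conj_iff_forall_normTest_iff L v (IsCMField.complexConj L) hcδ hδ w (hns w) hHh hH htU htP hν hν1 hgj hg'U).2 fun i => ?_
  rw [← he0 i, hNT j i, hj i]

end TypeOneClasses

end Summit.HodgeConjecture.HodgeConjecture.R90.S4

end
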